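import Summits.MatrixMultiplication.MatrixMultiplication.Theorems.SoloInformedTwistedTPPStructure

/-!
# The orbit model: Lemma L for a general multiplier group (any `m`)

This work, §8.4d REMARK (B3)_m / (R)_m. The cyclic model of `SoloInformedCyclicModel` has multipliers
`{±1}` (`m = 2`). Here the multiplier group is an arbitrary group `M` acting on the value group `S` by
additive automorphisms (`DistribMulAction M S`; for CU13-type realizations `M = μ_m ⊂ (ℤ/q)ˣ` acting on
`S = ℤ/q`, fixed-point-free): (E) on every index triple some multipliers solve
`a(i,j) + x • b(j,k) + y • c(k,i) = 0`; (Sep) on two distinct triples of one fibre `i+j+k = i'+j'+k'`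
no multipliers solve the mixed equation. Sign classes become `M`-ORBITS. This file sets the model up and
proves the two engines whose `m = 2` versions carry §8.4 verbatim: 1D-injectivity of the orbit classes
of `a` along the lines `i + j = const` (`a_injective_on_lines`) and the lazy lemma
(`c_injective_of_b_jlazy`: if the columns of `b` are constant in `j` up to multipliers then all `n²`
orbit classes of `c` are distinct). References: this work §8.4d; CohnUmans2013 (arXiv:1207.6528) Def. 12.
-/

namespace Summit.MatrixMultiplication.MatrixMultiplication.Theorems.TwistedTPP

/-- **The orbit model** (general multiplier group). Indices in a commutative group `G`, values in `S`,
multipliers a group `M` acting additively on `S`. [this work, §8.4d] -/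
structure OrbitModel (M G S : Type*) [Group M] [AddCommGroup G] [AddCommGroup S]
    [DistribMulAction M S] where
  /-- `S¹`-components of the orbit representatives of the three class maps -/
  a : G → G → S
  b : G → G → S
  c : G → G → S
  eqn : ∀ i j k : G, ∃ x y : M, a i j + x • b j k + y • c k i = 0
  sep : ∀ i j k i' j' k' : G, i + j + k = i' + j' + k' → (i, j, k) ≠ (i', j', k') →
    ∀ x y : M, a i j + x • b j' k + y • c k' i' ≠ 0

namespace OrbitModel

variable {M G S : Type*} [Group M] [AddCommGroup G] [AddCommGroup S] [DistribMulAction M S]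
  (R : OrbitModel M G S)

/-- `w` lies in the `M`-orbit of `u` (the orbit class relation; for `M = {±1}` this is `pm`). -/
def orb (u w : S) : Prop := ∃ z : M, z • u = w

/-- Orbit classes: reflexivity. -/
theorem orb_refl (u : S) : orb (M := M) u u := ⟨1, one_smul _ _⟩

/-- Orbit classes: symmetry. -/
theorem orb_symm {u w : S} (h : orb (M := M) u w) : orb (M := M) w u := by
  obtain ⟨z, hz⟩ := h
  exact ⟨z⁻¹, by rw [← hz, inv_smul_smul]⟩

/-- Orbit classes: transitivity. -/
theorem orb_trans {u w t : S} (h₁ : orb (M := M) u w) (h₂ : orb (M := M) w t) : orb (M := M) u t := by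
  obtain ⟨z₁, h₁⟩ := h₁
  obtain ⟨z₂, h₂⟩ := h₂
  exact ⟨z₂ * z₁, by rw [mul_smul, h₁, h₂]⟩

/-- Orbit classes are compatible with negation. -/
theorem orb_neg {u w : S} (h : orb (M := M) u w) : orb (M := M) (-u) (-w) := by
  obtain ⟨z, hz⟩ := h
  exact ⟨z, by rw [smul_neg, hz]⟩

/-- **Typed base pattern** (general multiplier group): every `c`-cell lies in the class of
`−(a(i,j₀) + x • b(j₀,k))` for some multiplier `x` — the `m` candidate classes of REMARK (R)_m
(for `m = 2`: `c(k,i) = ±(f_i ± l_k)`, `CyclicModel.c_pm_base`). -/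
theorem c_orb_base (i j₀ k : G) : ∃ x : M, orb (M := M) (R.c k i) (-(R.a i j₀ + x • R.b j₀ k)) := by
  obtain ⟨x, y, h⟩ := R.eqn i j₀ k
  exact ⟨x, y, by linear_combination (norm := abel1) h⟩

/-- **(B2)_m — `m²` candidates for an `a`-cell**: if the class of `c(k,i)` is known (`∼ t`), then
`a(i,j) = −x • b(j,k) − y • t` for some multipliers `x, y` (for `m = 2`: the four values
`±b(j,k) ± t`, `CyclicModel.a_pm_candidates`). -/
theorem a_orb_candidates {k i : G} {t : S} (ht : orb (M := M) (R.c k i) t) (j : G) :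
    ∃ x y : M, R.a i j = -(x • R.b j k) - y • t := by
  obtain ⟨z, hz⟩ := ht
  obtain ⟨x, y, h⟩ := R.eqn i j k
  refine ⟨x, y * z⁻¹, ?_⟩
  rw [mul_smul, ← hz, inv_smul_smul]
  linear_combination (norm := abel1) h

/-- **(B2)_m, transposed — `m²` candidate classes for a `c`-cell**: if the class of `a(i,j)` is known
(`∼ t`), then `c(k,i) = −y • t − x • b(j,k)` for some multipliers `x, y`. -/
theorem c_orb_candidates {i j : G} {t : S} (ht : orb (M := M) (R.a i j) t) (k : G) :
    ∃ x y : M, R.c k i = -(y • t) - x • R.b j k := by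
  obtain ⟨z, hz⟩ := ht
  obtain ⟨x, y, h⟩ := R.eqn i j k
  have hc : y • R.c k i = -R.a i j - x • R.b j k := by linear_combination (norm := abel1) h
  refine ⟨y⁻¹ * x, y⁻¹ * z⁻¹, ?_⟩
  rw [mul_smul, mul_smul, ← hz, inv_smul_smul, ← inv_smul_smul y (R.c k i), hc, smul_sub, smul_neg]

/-- **1D-injectivity for a general multiplier group.** Two cells of `a` on one line `i + j = i' + j'`
whose values lie in one `M`-orbit coincide: multiplying `E(i,j,0)` by the multiplier `z` carrying
`a(i,j)` to `a(i',j')` produces a vanishing mixed sum for the same-fibre pair `(i',j',0), (i,j,0)`. -/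
theorem a_injective_on_lines {i j i' j' : G} (hline : i + j = i' + j')
    (horb : orb (M := M) (R.a i j) (R.a i' j')) : i = i' ∧ j = j' := by
  by_contra hne
  obtain ⟨z, hz⟩ := horb
  obtain ⟨x, y, h⟩ := R.eqn i j 0
  have hs := R.sep i' j' 0 i j 0 (by rw [add_zero, add_zero, hline])
    (by intro e; simp only [Prod.mk.injEq] at e; exact hne ⟨e.1.symm, e.2.1.symm⟩) (z * x) (z * y)
  apply hs
  calc R.a i' j' + (z * x) • R.b j 0 + (z * y) • R.c 0 i
      = z • (R.a i j + x • R.b j 0 + y • R.c 0 i) := by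
        rw [← hz, smul_add, smul_add, mul_smul, mul_smul]
    _ = 0 := by rw [h, smul_zero]

/-- **`j`-lazy `b` forces injective `c`-classes** (general multiplier group). If every column of `b` is
constant in `j` up to multipliers, then all orbit classes of `c` are distinct: from `E(i',0,k')`, moving
the `b`-cell to row `j₂ = i'+k'-i-k` and the `c`-cell to `(k,i)` gives a vanishing mixed sum on the
same-fibre pair `(i',0,k'), (i,j₂,k)`. -/
theorem c_injective_of_b_jlazy (hb : ∀ j j' k : G, orb (M := M) (R.b j k) (R.b j' k)) {k i k' i' : G}
    (horb : orb (M := M) (R.c k' i') (R.c k i)) : k = k' ∧ i = i' := by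
  by_contra hne
  set j₂ : G := i' + k' - i - k with hj₂
  obtain ⟨z, hz⟩ := horb
  obtain ⟨w, hw⟩ := hb 0 j₂ k'
  obtain ⟨x, y, h⟩ := R.eqn i' 0 k'
  have hs := R.sep i' 0 k' i j₂ k (by rw [hj₂]; abel)
    (by intro e; simp only [Prod.mk.injEq] at e; exact hne ⟨e.2.2.symm, e.1.symm⟩) (x * w⁻¹) (y * z⁻¹)
  apply hs
  calc R.a i' 0 + (x * w⁻¹) • R.b j₂ k' + (y * z⁻¹) • R.c k i
      = R.a i' 0 + x • R.b 0 k' + y • R.c k' i' := by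
        rw [← hw, ← hz, mul_smul, mul_smul, inv_smul_smul, inv_smul_smul]
    _ = 0 := h

/-- Orbit classes are symmetric-transitive through a common representative. -/
theorem orb_of_orb_of_orb {u w t : S} (hu : orb (M := M) u t) (hw : orb (M := M) w t) :
    orb (M := M) u w := by
  obtain ⟨z₁, h₁⟩ := hu
  obtain ⟨z₂, h₂⟩ := hw
  exact ⟨z₂⁻¹ * z₁, by rw [mul_smul, h₁, ← h₂, inv_smul_smul]⟩

/-- **1D-injectivity of `c` along the lines `k + i = const`** (general multiplier group). -/
theorem c_injective_on_lines {k i k' i' : G} (hline : k + i = k' + i')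
    (horb : orb (M := M) (R.c k i) (R.c k' i')) : k = k' ∧ i = i' := by
  by_contra hne
  obtain ⟨z, hz⟩ := horb
  obtain ⟨x, y, h⟩ := R.eqn i 0 k
  have hs := R.sep i 0 k i' 0 k' (by rw [add_zero, add_zero, add_comm i k, add_comm i' k', hline])
    (by intro e; simp only [Prod.mk.injEq] at e; exact hne ⟨e.2.2, e.1⟩) x (y * z⁻¹)
  apply hs
  calc R.a i 0 + x • R.b 0 k + (y * z⁻¹) • R.c k' i'
      = R.a i 0 + x • R.b 0 k + y • R.c k i := by rw [← hz, mul_smul, inv_smul_smul]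
    _ = 0 := h

/-- **Block inequality for a general multiplier group** ((B1)_m of §8.4d): if on a block `I₀ × K₀` every
`c`-cell lies in the orbit class of one of the representatives in `T`, then `|I₀|·|K₀| ≤ |T|·|G|` — each
line `k + i = s` meets the block in at most `|T|` cells by `c_injective_on_lines`. For `M = μ_m` and
the base block of a popular level this is `μ₀ λ ≤ m n`. -/
theorem block_card_le [Fintype G] [DecidableEq G] (I₀ K₀ : Finset G) (T : Finset S)
    (hcls : ∀ i ∈ I₀, ∀ k ∈ K₀, ∃ t ∈ T, orb (M := M) (R.c k i) t) :
    I₀.card * K₀.card ≤ T.card * Fintype.card G := by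
  classical
  -- a representative map on the block
  let rep : G × G → S := fun p =>
    if h : p.1 ∈ I₀ ∧ p.2 ∈ K₀ then Classical.choose (hcls p.1 h.1 p.2 h.2) else 0
  have hrep : ∀ p ∈ I₀ ×ˢ K₀, rep p ∈ T ∧ orb (M := M) (R.c p.2 p.1) (rep p) := by
    intro p hp
    rw [Finset.mem_product] at hp
    have hspec := Classical.choose_spec (hcls p.1 hp.1 p.2 hp.2)
    simp only [rep, dif_pos hp]
    exact hspec
  have key : ∀ s ∈ (I₀ ×ˢ K₀).image (fun p : G × G => p.2 + p.1),
      ((I₀ ×ˢ K₀).filter (fun p : G × G => p.2 + p.1 = s)).card ≤ T.card := by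
    intro s _
    apply Finset.card_le_card_of_injOn rep
    · intro p hp
      rw [Finset.coe_filter] at hp
      exact (hrep p hp.1).1
    · intro p₁ hp₁ p₂ hp₂ heq
      rw [Finset.coe_filter] at hp₁ hp₂
      have o₁ := (hrep p₁ hp₁.1).2
      have o₂ := (hrep p₂ hp₂.1).2
      rw [heq] at o₁
      have hl : p₁.2 + p₁.1 = p₂.2 + p₂.1 := by rw [hp₁.2, hp₂.2]
      obtain ⟨hk, hi⟩ := R.c_injective_on_lines hl (orb_of_orb_of_orb o₁ o₂)
      exact Prod.ext hi hk
  calc I₀.card * K₀.card = (I₀ ×ˢ K₀).card := (Finset.card_product I₀ K₀).symm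
    _ ≤ T.card * ((I₀ ×ˢ K₀).image (fun p : G × G => p.2 + p.1)).card :=
        Finset.card_le_mul_card_image _ T.card key
    _ ≤ T.card * Fintype.card G := by
        gcongr
        exact Finset.card_le_univ _

/-- **Clique engine for a general multiplier group** ((B4)_m / Thm 8.7 (iii)): if `c(k',·)` takes one
orbit class at the rows `i` and `i + (j'+k) − (j+k')`, then the `b`-cells `(j,k) ≠ (j',k')` have different
orbit classes — from `E(i,j',k')`, moving `b` to `(j,k)` and `c` to `(k', i'')` gives a vanishing mixed
sum on the same-fibre pair `(i,j',k), (i'',j,k')`. -/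
theorem b_injective_of_c_agree {j k j' k' : G} (i : G)
    (hc : orb (M := M) (R.c k' i) (R.c k' (i + (j' + k) - (j + k'))))
    (horb : orb (M := M) (R.b j k) (R.b j' k')) : j = j' ∧ k = k' := by
  by_contra hne
  set i'' : G := i + (j' + k) - (j + k') with hdef
  obtain ⟨w, hw⟩ := hc
  obtain ⟨z, hz⟩ := horb
  obtain ⟨x, y, h⟩ := R.eqn i j' k'
  have hs := R.sep i j' k i'' j k' (by rw [hdef]; abel)
    (by intro e; simp only [Prod.mk.injEq] at e; exact hne ⟨e.2.1.symm, e.2.2⟩) (x * z) (y * w⁻¹)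
  apply hs
  calc R.a i j' + (x * z) • R.b j k + (y * w⁻¹) • R.c k' i''
      = R.a i j' + x • R.b j' k' + y • R.c k' i := by
        rw [← hz, ← hw, mul_smul, mul_smul, inv_smul_smul]
    _ = 0 := h

/-- **Chart injectivity for a general multiplier group** ((R3)_m): if `a(i,j) ∈ class(f_i + g_j)`,
`b(j,k) ∈ class(l_k − g_j)` and `c(k,i) ∈ class(−(f_i + l_k))` (flat translate form; the sign of `c` is
the one produced by normalising (E), so `−1 ∈ M` is not needed), then the chart `F = f + g + l` is
injective on each fibre: two same-fibre triples with `F(τ) = F(τ')` coincide, by (Sep) with the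
multipliers read off the three orbit witnesses. -/
theorem triple_eq_of_chart_eq (f g l : G → S)
    (hb : ∀ j k : G, orb (M := M) (R.b j k) (l k - g j))
    (hc : ∀ k i : G, orb (M := M) (R.c k i) (-(f i + l k)))
    {i j k i' j' k' : G} (ha : orb (M := M) (R.a i j) (f i + g j)) (hfib : i + j + k = i' + j' + k')
    (hF : f i + g j + l k = f i' + g j' + l k') : i = i' ∧ j = j' ∧ k = k' := by
  by_contra hne
  obtain ⟨za, hza⟩ := ha
  obtain ⟨zb, hzb⟩ := hb j' k
  obtain ⟨zc, hzc⟩ := hc k' i'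
  have hs := R.sep i j k i' j' k' hfib (by intro e; simp only [Prod.mk.injEq] at e; exact hne e)
    (za⁻¹ * zb) (za⁻¹ * zc)
  apply hs
  have h0 : (f i + g j) + (l k - g j') + -(f i' + l k') = 0 := by
    linear_combination (norm := abel1) hF
  calc R.a i j + (za⁻¹ * zb) • R.b j' k + (za⁻¹ * zc) • R.c k' i'
      = za⁻¹ • (za • R.a i j + zb • R.b j' k + zc • R.c k' i') := by
        rw [smul_add, smul_add, inv_smul_smul, mul_smul, mul_smul]
    _ = 0 := by rw [hza, hzb, hzc, h0, smul_zero]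

/-- **Normalised triangle equation** (general multiplier group; the typed gauge freedom of (B3)_m /
(R2)_m): if `a(i,j) ∈ class(x)` and `c(k,i) ∈ class(−t)` then `x + u • b(j,k) − y • t = 0` for some
multipliers `u, y`. Two rows of one level set thus give the pair of equations whose elimination of
`b(j,k)` is the single relation of REMARK (B3)_m. -/
theorem eqn_norm {i j k : G} {x t : S} (hx : orb (M := M) (R.a i j) x)
    (ht : orb (M := M) (R.c k i) (-t)) : ∃ u y : M, x + u • R.b j k - y • t = 0 := by
  obtain ⟨z, hz⟩ := hx
  obtain ⟨w, hw⟩ := ht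
  obtain ⟨u, y, h⟩ := R.eqn i j k
  refine ⟨z * u, z * y * w⁻¹, ?_⟩
  have hw' : w⁻¹ • t = -R.c k i := by rw [inv_smul_eq_iff, smul_neg, hw, neg_neg]
  have h1 : (z * y * w⁻¹) • t = -(z • (y • R.c k i)) := by rw [mul_smul, hw', smul_neg, mul_smul]
  have h2 : (z * u) • R.b j k = z • (u • R.b j k) := mul_smul _ _ _
  rw [h1, h2, ← hz, sub_neg_eq_add, ← smul_add, ← smul_add, h, smul_zero]

/-- **Lazy-row lemma for a general multiplier group**: if every row of `a` is constant in `j` up to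
multipliers, then all orbit classes of `c` are distinct (the degenerate family `𝓕₀` has rank `≥ n²` for
every `m`). -/
theorem lazy_row (hlazy : ∀ i j j' : G, orb (M := M) (R.a i j) (R.a i j')) {k i k' i' : G}
    (horb : orb (M := M) (R.c k i) (R.c k' i')) : k = k' ∧ i = i' := by
  by_contra hne
  set j'' : G := i' + k' - i - k with hj''
  obtain ⟨z, hz⟩ := hlazy i 0 j''
  obtain ⟨w, hw⟩ := horb
  obtain ⟨x, y, h⟩ := R.eqn i 0 k
  have hs := R.sep i j'' k i' 0 k' (by rw [hj'']; abel)
    (by intro e; simp only [Prod.mk.injEq] at e; exact hne ⟨e.2.2, e.1⟩) (z * x) (z * y * w⁻¹)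
  apply hs
  calc R.a i j'' + (z * x) • R.b 0 k + (z * y * w⁻¹) • R.c k' i'
      = z • (R.a i 0 + x • R.b 0 k + y • R.c k i) := by
        rw [← hz, ← hw, smul_add, smul_add, mul_smul, mul_smul, mul_smul, inv_smul_smul]
    _ = 0 := by rw [h, smul_zero]

/-- **`k`-lazy `c` forces injective `a`-classes** (general multiplier group; Thm 8.7 (i) for any `m`):
if `c(·, i)` is constant in `k` up to multipliers for every `i`, then all orbit classes of `a` are
distinct. -/
theorem a_injective_of_c_lazy (hk : ∀ k k' i : G, orb (M := M) (R.c k i) (R.c k' i)) {i j i' j' : G}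
    (horb : orb (M := M) (R.a i j) (R.a i' j')) : i = i' ∧ j = j' := by
  by_contra hne
  set k'' : G := i' + j' - i - j with hk''
  obtain ⟨z, hz⟩ := horb
  obtain ⟨w, hw⟩ := hk 0 k'' i
  obtain ⟨x, y, h⟩ := R.eqn i j 0
  have hs := R.sep i' j' 0 i j k'' (by rw [hk'']; abel)
    (by intro e; simp only [Prod.mk.injEq] at e; exact hne ⟨e.1.symm, e.2.1.symm⟩) (z * x) (z * y * w⁻¹)
  apply hs
  calc R.a i' j' + (z * x) • R.b j 0 + (z * y * w⁻¹) • R.c k'' i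
      = z • (R.a i j + x • R.b j 0 + y • R.c 0 i) := by
        rw [← hz, ← hw, smul_add, smul_add, mul_smul, mul_smul, mul_smul, inv_smul_smul]
    _ = 0 := by rw [h, smul_zero]

end OrbitModel

/-! ### The determinant dichotomy (REMARK (B3)_m / (R)_m): the ring arithmetic

For `M = μ_m ⊂ Fˣ` acting on `S = F` by multiplication, the pairs of normalised equations produced by
`OrbitModel.eqn_norm` are linear in the unknown `b`-value `v`; eliminating `v` is a `2 × 2` determinant.
Either the determinant is invertible — then a BASE value (`l` below) is pinned to an explicit expression,
hence to few values, hence popular — or it vanishes, which is the proportional / regaugeable case. -/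

/-- **(B3)_m relation.** Eliminating `v = b(j,k)` from the two normalised equations of rows `i, i'`
(`a`-class `αj` in column `j`, base classes `−(α + s l)`, `−(α + s' l)`) gives ONE linear relation among
`αj, α, l`; for `m = 2` it specialises to the four relations `2l = 0, 2α = 0, αj = ±α, αj = ±l`. -/
theorem sign_relation {F : Type*} [CommRing F] {αj α l v x x' y y' s s' : F}
    (e₁ : αj + x * v - y * (α + s * l) = 0) (e₂ : αj + x' * v - y' * (α + s' * l) = 0) :
    (x' - x) * αj + (x * y' - x' * y) * α + (x * y' * s' - x' * y * s) * l = 0 := by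
  linear_combination x' * e₁ - x * e₂

/-- **(R1)_m level-pair relation.** Two big levels `t₁ = a₁ l − x₁ v`, `t₂ = a₂ l − x₂ v` of one column
read at the same `k` pin BOTH base values by the determinant `x₂a₁ − x₁a₂`: if it is a unit, `l_k` and
`v_k` are explicit in `t₁, t₂` (few values ⟹ a popular class); if it vanishes the levels are proportional. -/
theorem level_pair_relation {F : Type*} [CommRing F] {t₁ t₂ a₁ a₂ x₁ x₂ l v : F}
    (e₁ : t₁ = a₁ * l - x₁ * v) (e₂ : t₂ = a₂ * l - x₂ * v) :
    (x₂ * a₁ - x₁ * a₂) * l = x₂ * t₁ - x₁ * t₂ ∧ (x₂ * a₁ - x₁ * a₂) * v = a₂ * t₁ - a₁ * t₂ := by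
  constructor
  · linear_combination - x₂ * e₁ + x₁ * e₂
  · linear_combination - a₂ * e₁ + a₁ * e₂

/-- The proportional case made explicit over a field: if the determinant vanishes and `x₁ ≠ 0`, then
`x₁ t₂ = x₂ t₁`, i.e. `t₂ = (x₂/x₁) t₁` lies in the multiplier class of `t₁` when `x₂/x₁ ∈ M`. -/
theorem level_pair_proportional {F : Type*} [CommRing F] {t₁ t₂ a₁ a₂ x₁ x₂ l v : F}
    (e₁ : t₁ = a₁ * l - x₁ * v) (e₂ : t₂ = a₂ * l - x₂ * v) (hdet : x₂ * a₁ - x₁ * a₂ = 0) :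
    x₁ * t₂ = x₂ * t₁ := by
  linear_combination (-x₂) * e₁ + x₁ * e₂ + (-l) * hdet

/-- **(B3)_m — sign rigidity over a domain** (the trichotomy behind REMARK (B3)_m; for `m = 2` it is
`CyclicModelGauge.sign_rigidity_pm`).  Two rows whose `a`-cells in column `j` agree (`αj`) and whose
`c`-cells in column `k` read `α + s·l`, `α + s'·l` with DIFFERENT twists `s ≠ s'` give, after
normalisation, `e₁, e₂`; then either `α = 0`, or the base value `l` is pinned by the unit sextuple and
`(αj, α)`, or `αj` is pinned by the unit quadruple and `α`. -/
theorem sign_trichotomy {F : Type*} [CommRing F] [IsDomain F] {αj α l v x x' y y' s s' : F}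
    (e₁ : αj + x * v - y * (α + s * l) = 0) (e₂ : αj + x' * v - y' * (α + s' * l) = 0)
    (hs : s ≠ s') (hx : x ≠ 0) (hy : y ≠ 0) :
    α = 0 ∨
      (x * y' * s' - x' * y * s ≠ 0 ∧
        (x * y' * s' - x' * y * s) * l = -((x' - x) * αj + (x * y' - x' * y) * α)) ∨
      (x * y' * s' - x' * y * s = 0 ∧ x' - x ≠ 0 ∧
        (x' - x) * αj = -((x * y' - x' * y) * α)) := by
  have R := sign_relation e₁ e₂
  by_cases h₁ : x * y' * s' - x' * y * s = 0
  · by_cases h₂ : x' - x = 0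
    · have hxx : x' = x := sub_eq_zero.mp h₂
      subst hxx
      have hys : y' * s' = y * s :=
        mul_left_cancel₀ hx (show x' * (y' * s') = x' * (y * s) by linear_combination h₁)
      have hα : (y' - y) * α = 0 :=
        mul_left_cancel₀ hx (show x' * ((y' - y) * α) = x' * 0 by linear_combination R - l * h₁)
      rcases mul_eq_zero.mp hα with h | h
      · have hyy : y' = y := sub_eq_zero.mp h
        rw [hyy] at hys
        exact absurd (mul_left_cancel₀ hy hys).symm hs
      · exact Or.inl h
    · exact Or.inr (Or.inr ⟨h₁, h₂, by linear_combination R - l * h₁⟩)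
  · exact Or.inr (Or.inl ⟨h₁, by linear_combination R⟩)

/-- **Pinned columns** (the counting half of the determinant dichotomy, REMARK (R)_m / (R1)_m): if two
levels `t₁, t₂` are read in the columns `k ∈ K₀` as `t_r = a_r(k) · l_k − x_r(k) · v_k` with coefficients
in a finite set `U` (the multipliers), then the columns with INVERTIBLE determinant
`x₂(k)a₁(k) − x₁(k)a₂(k) ≠ 0` have their base value `l_k` pinned by the coefficient quadruple
(`level_pair_relation` + cancellation), so there are at most `μ · |U|⁴` of them, `μ` = the maximal
multiplicity of a value of `l`.  (On the remaining columns the determinant vanishes and the levels are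
proportional, `level_pair_proportional`.) -/
theorem card_pinned_columns_le {K F : Type*} [Fintype K] [CommRing F] [IsDomain F] [DecidableEq F]
    (U : Finset F) (K₀ : Finset K) (l v a₁ a₂ x₁ x₂ : K → F) (t₁ t₂ : F) (μ : ℕ)
    (hU : ∀ k ∈ K₀, a₁ k ∈ U ∧ a₂ k ∈ U ∧ x₁ k ∈ U ∧ x₂ k ∈ U)
    (he₁ : ∀ k ∈ K₀, t₁ = a₁ k * l k - x₁ k * v k) (he₂ : ∀ k ∈ K₀, t₂ = a₂ k * l k - x₂ k * v k)
    (hμ : ∀ y : F, (Finset.univ.filter fun k => l k = y).card ≤ μ) :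
    (K₀.filter fun k => x₂ k * a₁ k - x₁ k * a₂ k ≠ 0).card ≤ μ * U.card ^ 4 := by
  classical
  set s := K₀.filter fun k => x₂ k * a₁ k - x₁ k * a₂ k ≠ 0 with hs
  let φ : K → F × F × F × F := fun k => (a₁ k, a₂ k, x₁ k, x₂ k)
  have hfib : ∀ b ∈ s.image φ, (s.filter fun k => φ k = b).card ≤ μ := by
    intro b hb
    obtain ⟨k₀, hk₀, rfl⟩ := Finset.mem_image.mp hb
    refine le_trans (Finset.card_le_card ?_) (hμ (l k₀))
    intro k hk
    rw [Finset.mem_filter] at hk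
    obtain ⟨hks, hφ⟩ := hk
    simp only [Finset.mem_filter, Finset.mem_univ, true_and]
    obtain ⟨hkK, hdet⟩ := Finset.mem_filter.mp hks
    obtain ⟨hk₀K, -⟩ := Finset.mem_filter.mp hk₀
    simp only [φ, Prod.mk.injEq] at hφ
    obtain ⟨e₁, e₂, e₃, e₄⟩ := hφ
    have r := (level_pair_relation (he₁ k hkK) (he₂ k hkK)).1
    have r₀ := (level_pair_relation (he₁ k₀ hk₀K) (he₂ k₀ hk₀K)).1
    rw [e₁, e₂, e₃, e₄] at r hdet
    exact mul_left_cancel₀ hdet (r.trans r₀.symm)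
  calc s.card ≤ μ * (s.image φ).card := Finset.card_le_mul_card_image _ _ hfib
    _ ≤ μ * U.card ^ 4 := by
        apply Nat.mul_le_mul_left
        calc (s.image φ).card ≤ (U ×ˢ U ×ˢ U ×ˢ U).card := Finset.card_le_card (by
                intro b hb
                obtain ⟨k, hk, rfl⟩ := Finset.mem_image.mp hb
                have hk' := hU k (Finset.mem_filter.mp hk).1
                simp only [φ, Finset.mem_product]
                exact ⟨hk'.1, hk'.2.1, hk'.2.2.1, hk'.2.2.2⟩)
          _ = U.card ^ 4 := by simp only [Finset.card_product]; ring

end Summit.MatrixMultiplication.MatrixMultiplication.Theorems.TwistedTPP
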